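import Mathlib
import HarnessLib
import Summits.HubbardSuperconductivity.HubbardSuperconductivity.Theorems.KLProgrammeKLRegimeSplitFrameSegmentDefs
import Summits.HubbardSuperconductivity.HubbardSuperconductivity.Theorems.KLProgrammeKLRegimeSplitStagePieces
import Summits.HubbardSuperconductivity.HubbardSuperconductivity.Theorems.KLProgrammeKLRegimeSplitOnWindow

/-!
# Route `KLProgramme` — the admissible classes along the SEGMENT between two admissible frames:
# `frameOK_faffine` (the FULL class `FrameOK`, under the regime's smallness sums) and `frameOK₂_faffine` (the slackened class `FrameOK₂`,
# under a `C²`-distance hypothesis only)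

Cell `gate-hubbard-kl`, seat hubbard-kl-k3c3-p3 (g8; row «implicit-function / monotonicity route for μ(n)»); engine-flow child
`KLRegimeEngineV17F2` (stmt-HubbardSuperconductivity-20437), stub (C) `stub_twoLeg_curvature`, located risk «(C)-B-REP» / (SEG): the
corrected (B) door (p2 g12) interpolates the frame `K_t = (1 − t)K₀ + tK₁` between two admissible frames and reads the tower at `K_t`
(E1's TOWER-LIPSCHITZ (F) = YES, KL STATUS l.3518 (R59v)(D); conditional duty of this seat, l.3431 (R59d) / l.3502 (R59s)).
* §1 the jet clause is CONVEX: `‖Dʲ evalM (faffine t A B)‖ ≤ (1 − t)‖Dʲ evalM A‖ + t‖Dʲ evalM B‖`, so pieces with a common allowance keep it;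
* §2 **`frameOK_faffine`** — `FrameOK R U N μ K₀`, `FrameOK R U N μ K₁`, `t ∈ [0, 1]`, `μ ∈ klWindowC` and the regime's three smallness
  sums of the piece allowances (VERBATIM the hypotheses `h0 h1 h2` of p2's `frameOK_of_pieces`: `Σ_n Gfr₀·uPow 0 U·4^{-2n} ≤ 3/80`,
  `Σ_n Gfr₁·uPow 1 U·4^{-n} ≤ 1/2000`, `Σ_n Σ_{j<3} … ≤ 1/100`) ⟹ `FrameOK R U N μ (faffine t K₀ K₁)` — the FULL class, so every
  `FrameOK`-keyed door applies at `K_t` unchanged (clause (ii) is convex; clause (i) is RE-DERIVED from the segment's pieces by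
  `frameOK_of_pieces`, which is how admissibility is certified in the first place — this answers p2's l.3496 caveat that clause (i) ALONE
  is not convex);
* §3 **`frameOK₂_faffine`** — WITHOUT the sums: `FrameOK … K₀`, `FrameOK … K₁`, `t ∈ [0, 1]` and the `C²`-closeness of the endpoints
  `|K₁ − K₀| ≤ 3/160`, `‖D(K₁ − K₀)‖ ≤ 1/8000`, `‖Dʲ(K₁ − K₀)‖ ≤ 1/400 (j ≤ 2)` on `Momentum` ⟹ `FrameOK₂ R U N μ (faffine t K₀ K₁)`
  (the name of record: constants `(7, 3/160, 1/4, 3/400)`; derivative bound `7` kept by convexity, the two lower bounds by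
  `GeomConstants.of_perturbation` from the endpoint `K₀`); `FrameOK.frameOK₂` (every admissible frame is in the slackened class).
Everything is PROVED; no definitions; nothing about the Hubbard model beyond the free band.  References: FST II §2 (geometric constants)
[cite: FeldmanSalmhoferTrubowitz1998]; BGM 2006 §2.4 Lemma 2.1 [cite: BenfattoGiulianiMastropietro2006].
-/

noncomputable section

namespace Summit.HubbardSuperconductivity.HubbardSuperconductivity.Theorems.KLRegimeSplit

set_option linter.dupNamespace false -- summit = problem name (single-conjunct summit), D-0017

open Real Finset Literature.MathematicalPhysics.QuantumLattice Literature.MathematicalPhysics.QuantumLattice.FermiRG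
open Summit.HubbardSuperconductivity.HubbardSuperconductivity.Theorems.DispersionFlow

/-! ## §1 The jet clause is convex -/

/-- **Convexity of the jet sizes along the segment**: `‖Dʲ evalM (faffine t A B) q‖ ≤ (1 − t)·‖Dʲ evalM A q‖ + t·‖Dʲ evalM B q‖` for
`t ∈ [0, 1]`. -/
theorem norm_iteratedFDeriv_evalM_faffine_le {t : ℝ} (ht0 : 0 ≤ t) (ht1 : t ≤ 1) (A B : TrigPolyC4v) (j : ℕ) (q : Momentum) :
    ‖iteratedFDeriv ℝ j (evalM (faffine t A B)) q‖ ≤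
      (1 - t) * ‖iteratedFDeriv ℝ j (evalM A) q‖ + t * ‖iteratedFDeriv ℝ j (evalM B) q‖ := by
  have hA : ContDiffAt ℝ j (evalM A) q := (contDiff_evalM A).contDiffAt
  have hB : ContDiffAt ℝ j (evalM B) q := (contDiff_evalM B).contDiffAt
  have hA' : ContDiffAt ℝ j ((1 - t) • evalM A) q := hA.const_smul (1 - t)
  have hB' : ContDiffAt ℝ j (t • evalM B) q := hB.const_smul t
  rw [evalM_faffine_eq, iteratedFDeriv_add_apply hA' hB', iteratedFDeriv_const_smul_apply hA, iteratedFDeriv_const_smul_apply hB]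
  refine (norm_add_le _ _).trans (le_of_eq ?_)
  rw [norm_smul, norm_smul, Real.norm_of_nonneg (by linarith), Real.norm_of_nonneg ht0]

/-- Pieces with a common allowance keep it along the segment. -/
theorem norm_iteratedFDeriv_evalM_faffine_le_of_le {t : ℝ} (ht0 : 0 ≤ t) (ht1 : t ≤ 1) {A B : TrigPolyC4v} {j : ℕ} {q : Momentum}
    {G : ℝ} (hA : ‖iteratedFDeriv ℝ j (evalM A) q‖ ≤ G) (hB : ‖iteratedFDeriv ℝ j (evalM B) q‖ ≤ G) :
    ‖iteratedFDeriv ℝ j (evalM (faffine t A B)) q‖ ≤ G := by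
  refine (norm_iteratedFDeriv_evalM_faffine_le ht0 ht1 A B j q).trans ?_
  have h1 : (1 - t) * ‖iteratedFDeriv ℝ j (evalM A) q‖ ≤ (1 - t) * G := mul_le_mul_of_nonneg_left hA (by linarith)
  have h2 : t * ‖iteratedFDeriv ℝ j (evalM B) q‖ ≤ t * G := mul_le_mul_of_nonneg_left hB ht0
  linarith

/-- **The segment's pieces**: if `K₀ = Σ_{n ≤ N} Kp₀ n` and `K₁ = Σ_{n ≤ N} Kp₁ n` (as functions), then
`faffine t K₀ K₁ = Σ_{n ≤ N} faffine t (Kp₀ n) (Kp₁ n)`. -/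
theorem eval_faffine_eq_sum_pieces {t : ℝ} {K₀ K₁ : TrigPolyC4v} {Kp₀ Kp₁ : ℕ → TrigPolyC4v} {N : ℕ}
    (hs₀ : ∀ p : Fin 2 → ℝ, K₀.eval p = ∑ n ∈ range (N + 1), (Kp₀ n).eval p)
    (hs₁ : ∀ p : Fin 2 → ℝ, K₁.eval p = ∑ n ∈ range (N + 1), (Kp₁ n).eval p) (p : Fin 2 → ℝ) :
    (faffine t K₀ K₁).eval p = ∑ n ∈ range (N + 1), (faffine t (Kp₀ n) (Kp₁ n)).eval p := by
  simp only [eval_faffine, hs₀ p, hs₁ p, mul_sum, ← sum_add_distrib]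

/-! ## §2 The FULL class along the segment, under the regime's smallness sums -/

/-- **`FrameOK` IS KEPT ALONG THE SEGMENT** (under the regime's smallness sums).  For two admissible frames `K₀, K₁ ∈ FrameOK R U N μ`
on the covariance window and `t ∈ [0, 1]`: the pieces of `faffine t K₀ K₁` are the affine combinations of the pieces, with the SAME
allowances (convexity, §1); clause (i) is then re-derived from those pieces by `frameOK_of_pieces` under its three smallness sums
(hypotheses `h0 h1 h2` verbatim) — so the FULL class `FrameOK R U N μ (faffine t K₀ K₁)` holds and every `FrameOK`-keyed door
applies at the interpolated frame.  [cite: BenfattoGiulianiMastropietro2006, §2.4 Lemma 2.1] -/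
theorem frameOK_faffine {R : RenConsts} (hR : ∀ j, 0 ≤ R.Gfr j) {U μ : ℝ} {N : ℕ} {K₀ K₁ : TrigPolyC4v} (hμ : μ ∈ klWindowC)
    (hK₀ : FrameOK R U N μ K₀) (hK₁ : FrameOK R U N μ K₁) {t : ℝ} (ht0 : 0 ≤ t) (ht1 : t ≤ 1)
    (h0 : ∑ n ∈ range (N + 1), R.Gfr 0 * uPow 0 U * (4 : ℝ) ^ (((0 : ℤ) - 2) * n) ≤ 3 / 80)
    (h1 : ∑ n ∈ range (N + 1), R.Gfr 1 * uPow 1 U * (4 : ℝ) ^ (((1 : ℤ) - 2) * n) ≤ 1 / 2000)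
    (h2 : ∑ n ∈ range (N + 1), ∑ j ∈ range 3, R.Gfr j * uPow j U * (4 : ℝ) ^ (((j : ℤ) - 2) * n) ≤ 1 / 100) :
    FrameOK R U N μ (faffine t K₀ K₁) := by
  obtain ⟨-, Kp₀, hs₀, hb₀⟩ := hK₀
  obtain ⟨-, Kp₁, hs₁, hb₁⟩ := hK₁
  have hμ' : μ ∈ Set.Icc (-1.05 : ℝ) (-0.15) := by simpa only [klWindowC] using hμ
  refine frameOK_of_pieces hR hμ' (Kp := fun n => fsub 0 (faffine t (Kp₀ n) (Kp₁ n))) (fun p => ?_) (fun n hn j hj q => ?_) h0 h1 h2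
  · rw [eval_faffine_eq_sum_pieces hs₀ hs₁ p]
    refine sum_congr rfl fun n _ => ?_
    simp only [eval_fsub, TrigPolyC4v.eval_zero, zero_sub, neg_neg]
  · rw [evalM_fsub_zero, iteratedFDeriv_neg_apply, norm_neg]
    exact norm_iteratedFDeriv_evalM_faffine_le_of_le ht0 ht1 (hb₀ n hn j hj q) (hb₁ n hn j hj q)

/-! ## §3 The slackened class along the segment, under `C²`-closeness only -/

/-- Every admissible frame is in the slackened class. -/
theorem FrameOK.frameOK₂ {R : RenConsts} {U μ : ℝ} {N : ℕ} {K : TrigPolyC4v} (hK : FrameOK R U N μ K) : FrameOK₂ R U N μ K :=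
  ⟨GeomConstants.weaken hK.1 le_rfl (by norm_num) (by norm_num) (by norm_num) (by norm_num) (by norm_num) (by norm_num), hK.2⟩

/-- The band along the segment is the start band plus `t` times the (negative) frame difference:
`frameLevel μ (faffine t K₀ K₁) = frameLevel μ K₀ + (−t) • evalM (K₁ ⊖ K₀)`. -/
theorem frameLevel_faffine_eq_add (μ t : ℝ) (K₀ K₁ : TrigPolyC4v) :
    frameLevel μ (faffine t K₀ K₁) = frameLevel μ K₀ + (-t) • evalM (fsub K₁ K₀) := by
  funext q
  simp only [Pi.add_apply, Pi.smul_apply, smul_eq_mul, frameLevel, evalM_apply, eval_faffine_eq_add_fsub]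
  ring

/-- The band along the segment is the convex combination of the endpoint bands (as functions). -/
theorem frameLevel_faffine_eq_smul_add (μ t : ℝ) (K₀ K₁ : TrigPolyC4v) :
    frameLevel μ (faffine t K₀ K₁) = (1 - t) • frameLevel μ K₀ + t • frameLevel μ K₁ := by
  funext q
  simp only [Pi.add_apply, Pi.smul_apply, smul_eq_mul, frameLevel_faffine]

/-- **`FrameOK₂` ALONG THE SEGMENT, from `C²`-closeness of the endpoints** (no smallness sums).  For `K₀, K₁ ∈ FrameOK R U N μ`,
`t ∈ [0, 1]`, and the frame difference `K₁ ⊖ K₀` small in `C²` on `Momentum` — `|evalM (K₁ ⊖ K₀)| ≤ 3/160`,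
`‖D evalM (K₁ ⊖ K₀)‖ ≤ 1/8000`, `‖Dʲ evalM (K₁ ⊖ K₀)‖ ≤ 1/400` (`j ≤ 2`) — the interpolated frame is in the slackened class:
derivative bound `7` by convexity, the transversality `|∇e| ≥ 1/4` on `{|e| < 3/160}` and the tangential Hessian floor `3/400` by
`GeomConstants.of_perturbation` from `K₀` (`wmin(1−ρ)² − Kρ(2+3ρ) − b ≥ 3/400` at `ρ ≤ 1/4000`, `b ≤ 1/400`); jet clause by §1.
In the engine the endpoints are consecutive flow frames at `C²`-distance `O(Gfr·U²)`, far inside these thresholds.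
[cite: FeldmanSalmhoferTrubowitz1998, §2 Lemma 2.1] -/
theorem frameOK₂_faffine {R : RenConsts} {U μ : ℝ} {N : ℕ} {K₀ K₁ : TrigPolyC4v} (hK₀ : FrameOK R U N μ K₀) (hK₁ : FrameOK R U N μ K₁)
    {t : ℝ} (ht0 : 0 ≤ t) (ht1 : t ≤ 1)
    (hd₀ : ∀ q : Momentum, |evalM (fsub K₁ K₀) q| ≤ 3 / 160)
    (hd₁ : ∀ q : Momentum, ‖fderiv ℝ (evalM (fsub K₁ K₀)) q‖ ≤ 1 / 8000)
    (hd₂ : ∀ q : Momentum, ∀ j ≤ 2, ‖iteratedFDeriv ℝ j (evalM (fsub K₁ K₀)) q‖ ≤ 1 / 400) :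
    FrameOK₂ R U N μ (faffine t K₀ K₁) := by
  obtain ⟨hG₀, Kp₀, hs₀, hb₀⟩ := hK₀
  obtain ⟨hG₁, Kp₁, hs₁, hb₁⟩ := hK₁
  refine ⟨?_, fun n => faffine t (Kp₀ n) (Kp₁ n), eval_faffine_eq_sum_pieces hs₀ hs₁,
    fun n hn j hj q => norm_iteratedFDeriv_evalM_faffine_le_of_le ht0 ht1 (hb₀ n hn j hj q) (hb₁ n hn j hj q)⟩
  -- clause (i): the perturbation `D = (−t)•(K₁ ⊖ K₀)` of the start band
  set D : Momentum → ℝ := (-t) • evalM (fsub K₁ K₀) with hDdef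
  -- the frame bands are `C^∞` (`ε − μ` minus a trigonometric polynomial; cf. `EngineV8.contDiff_frameLevel`)
  have hcd : ∀ (K : TrigPolyC4v) (n : WithTop ℕ∞), ContDiff ℝ n (frameLevel μ K) := fun K n => by
    rw [frameLevel_eq_add]; exact (klfs_contDiff_e μ).add (contDiff_evalM K).neg
  have he : ContDiff ℝ 2 (frameLevel μ K₀) := hcd K₀ 2
  have hDc : ContDiff ℝ 2 D := (contDiff_evalM (fsub K₁ K₀)).const_smul (-t)
  have hat : |(-t)| ≤ 1 := by rw [abs_neg, abs_of_nonneg ht0]; exact ht1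
  have hD0 : ∀ q, |D q| ≤ 3 / 160 := fun q => by
    rw [hDdef, Pi.smul_apply, smul_eq_mul, abs_mul]
    exact (mul_le_mul hat (hd₀ q) (abs_nonneg _) zero_le_one).trans (by rw [one_mul])
  have n1 : ∀ g : Momentum → ℝ, ∀ q : Momentum, ‖fderiv ℝ g q‖ = ‖iteratedFDeriv ℝ 1 g q‖ := fun g q => by
    rw [← norm_iteratedFDeriv_fderiv, norm_iteratedFDeriv_zero]
  have hD1 : ∀ q, ‖fderiv ℝ D q‖ ≤ 1 / 8000 := fun q => by
    rw [n1, hDdef, iteratedFDeriv_const_smul_apply (contDiff_evalM (fsub K₁ K₀)).contDiffAt, norm_smul, Real.norm_eq_abs, ← n1]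
    exact (mul_le_mul hat (hd₁ q) (norm_nonneg _) zero_le_one).trans (by rw [one_mul])
  have hD2 : ∀ q, ∀ j ≤ 2, ‖iteratedFDeriv ℝ j D q‖ ≤ 1 / 400 := fun q j hj => by
    rw [hDdef, iteratedFDeriv_const_smul_apply (contDiff_evalM (fsub K₁ K₀)).contDiffAt, norm_smul, Real.norm_eq_abs]
    exact (mul_le_mul hat (hd₂ q j hj) (norm_nonneg _) zero_le_one).trans (by rw [one_mul])
  have hfloor : ∀ p : Momentum, |frameLevel μ K₀ p| < 3 / 80 → ∀ v : Momentum,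
      inner ℝ (gradient (frameLevel μ K₀ + D) p) v = 0 → -(1 / 400) * ‖v‖ ^ 2 ≤ hessQuad D p v := by
    intro p _ v _
    have hq := abs_fderiv_fderiv_le D p v v
    rw [← hessQuad_eq_fderiv_fderiv] at hq
    have h2 := hD2 p 2 le_rfl
    have hv : 0 ≤ ‖v‖ * ‖v‖ := by positivity
    have := (abs_le.mp (hq.trans (by nlinarith [h2, hv] : ‖iteratedFDeriv ℝ 2 D p‖ * ‖v‖ * ‖v‖ ≤ 1 / 400 * ‖v‖ ^ 2))).1
    linarith
  have hP := GeomConstants.of_perturbation hG₀ he hDc hD0 hD1 hD2 hfloor (by norm_num) (by norm_num) (by norm_num) (by norm_num)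
  have hED : frameLevel μ (faffine t K₀ K₁) = frameLevel μ K₀ + D := frameLevel_faffine_eq_add μ t K₀ K₁
  rw [hED]
  refine ⟨by norm_num, by norm_num, by norm_num, fun p j hj => ?_, fun p hp => ?_, fun p hp v hv => ?_⟩
  · -- derivative bound `7` by convexity of the endpoint bounds
    rw [← hED, frameLevel_faffine_eq_smul_add]
    have c₀ : ContDiffAt ℝ j (frameLevel μ K₀) p := (hcd K₀ j).contDiffAt
    have c₁ : ContDiffAt ℝ j (frameLevel μ K₁) p := (hcd K₁ j).contDiffAt
    have c₀' : ContDiffAt ℝ j ((1 - t) • frameLevel μ K₀) p := c₀.const_smul (1 - t)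
    have c₁' : ContDiffAt ℝ j (t • frameLevel μ K₁) p := c₁.const_smul t
    rw [iteratedFDeriv_add_apply c₀' c₁', iteratedFDeriv_const_smul_apply c₀, iteratedFDeriv_const_smul_apply c₁]
    refine (norm_add_le _ _).trans ?_
    rw [norm_smul, norm_smul, Real.norm_of_nonneg (by linarith), Real.norm_of_nonneg ht0]
    have e₀ := hG₀.norm_iteratedFDeriv_le p j hj
    have e₁ := hG₁.norm_iteratedFDeriv_le p j hj
    nlinarith
  · -- transversality: `1/4 ≤ 1/2 − 1/8000 ≤ ‖∇(e + D)‖` on the narrower tube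
    have h := hP.le_norm_gradient p (hp.trans_le (by norm_num))
    exact le_trans (by norm_num) h
  · -- tangential Hessian floor `3/400`
    have h := hP.le_hessQuad p (hp.trans_le (by norm_num)) v hv
    refine le_trans (mul_le_mul_of_nonneg_right (by norm_num) (sq_nonneg _)) h

end Summit.HubbardSuperconductivity.HubbardSuperconductivity.Theorems.KLRegimeSplit

end
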